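import Summits.QuantumFields.BalabanUV.Beta.GAN24.FibInvClosedForm
import Summits.QuantumFields.BalabanUV.Beta.GAN24.CombesThomasFibreStep

/-!
# `BalabanUV.Beta.GAN24.KFibLegSource` — binder row G-an2-4 / (CONV-C), road P1-fibre, leaf **P1-L05b** (part 2/3): the `b`-LEG SUM of the fibre function
# `CombesThomasFibreStep.kFib` pushed onto the right-hand side of the fibre system — the LEG SOURCE VECTOR, its Bloch-aggregated sources (M-level SOURCE
# WEIGHT), and the linearity that turns weighted sums of `fibInv` entries into entries of `(fibreMatrix)⁻¹ *ᵥ (leg source vector)` (S1c of `SKELETON-P1.md`)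

NOT IN PRINT; OUR PROOF ATTEMPT.  HONEST FRAMING (cell contract, verbatim): «discharging `BetaPertH` makes Bałaban's UV stability UNCONDITIONAL — a real
constructive-QFT result; it is NOT the continuum limit and NOT the Clay problem.»  HONEST DEPENDENCY (verbatim): «continuum YM on T⁴ ⇐ BetaPertH ∧ nine spine
estimates (0/9 proved); BetaPertH ⇐ (D1) ∧ (D4) ∧ CAP+tail; G-an2-4 gates asym, D1 and NE2/3/4.»  [folklore] finite sums / finite-dimensional linear algebra over `ℂ`:
an IDENTIFICATION (no estimate, no cited fact, no wall binder, no `def … : Prop` fact).  NOT summit progress; nothing of (CONV-C)'s K-slot is discharged here.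

## What is proved (generic `d`; blocking `N ≥ 1`, decimation `M`; REAL quasi-momentum `p = ofRealVec q` with `hL : ∀ m, L_m ≠ 0` where stated)
§1 LINEARITY: `Σ_j fibInv N i j p · r j = ((fibreMatrix (blochChar p))⁻¹ *ᵥ r) i` and this vector solves the fibre system with right-hand side `r`
   (`sum_fibInv_mul`, `fibreFun_invMulVec`); hence its entries have leaf-06's bordered-inverse form for ANY capacitance solution with the sources of `r`
   (`invMulVec_inl`, `invMulVec_inr_inr`).
§2 THE LEG SOURCE VECTOR `legSrcVec N M p C b y′ := Σ_{i′ ∈ legSet b} C · cphase(−quo N P′_{i′}) p • e_{legIdx b P′_{i′}}` (the `b`-leg sum of `kFibW` as a right-hand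
   side; `sum_leg_fibInv_eq_invMulVec`) and its sources: for a FIELD leg `b = inl l` the EL-source is `fieldLegSrc = [κ′ = l] · C · N^{−(d+1)} · srcW` with the
   M-level SOURCE WEIGHT `srcW N M p l y′ m = Σ_{i′ ∈ LegIdx d M} pw(−k_m)(legPt M (inl l) y′ i′)` (`= conj(e^{ik_m·My′}S_M(m)s_{M,l}(m))` at real `p`) and the G/M/Q
   sources vanish; for a MULTIPLIER leg `b = inr l` only the Q-source `C · cphase(−quo N (M•y′)) p • e_l` survives (`srcEL_legSrcVec_inl`, `srcG_legSrcVec_inl`,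
   `legSrcVec_inl_M/Q`, `legSrcVec_inr_apply`, `srcEL/srcG_legSrcVec_inr`, `legSrcVec_inr_M/Q`).  Auxiliary: `cphase_eq_blochChar`, `pw_neg_kFine_site`,
   `cphase_mul_pw_kFine_repZ` (plane waves at fine points factor through the block, `FibreDFT.pw_kFine_site`).
Part 3/3 (`GAN24/KFibClosedForm`): the readout collapses to the M-level READING WEIGHT and the four closed-form identities for `kFibW`/`kFib`.
Unit `b2b-balaban-gan24-formalise-leaf-05` (G-an2-4 formalisation swarm), 2026-08-20.
-/

noncomputable section

open Complex Finset
open scoped BigOperators Matrix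
open Literature.MathematicalPhysics.QuantumFieldTheory
open Literature.MathematicalPhysics.QuantumFieldTheory.Balaban1983to89
open Literature.MathematicalPhysics.QuantumFieldTheory.Balaban1983to89.Beta
open Literature.MathematicalPhysics.QuantumFieldTheory.LatticeForm (repZ quo)
open Literature.Probability.LatticeModels (TorusSite Torus.proj)
open B4Strip (ofRealVec)
open AffineAveraging (Site)
open BlochFibreMatrix (Idx blochChar blochChar_apply fibreFun fibreMatrix fibreMatrix_mulVec)
open FibreInverseDecay (cphase)
open OneStepResolventKernel (Fib)
open OneStepKernelFamily (LegIdx legSet legPt legW)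
open Summit.QuantumFields.BalabanUV.Beta.HessKerDressedUnits (legScale)
open Summit.QuantumFields.BalabanUV.Beta.GAN24.FibreSymbols (pw lapSym)
open Summit.QuantumFields.BalabanUV.Beta.GAN24.FibreDFT (kFine amp pw_neg pw_kFine_site)
open Summit.QuantumFields.BalabanUV.Beta.GAN24.CapacitanceSolve (Fibre CapSolves Ablk)
open Summit.QuantumFields.BalabanUV.Beta.GAN24.FibreArrow (srcEL rG srcG aliasFibre)
open Summit.QuantumFields.BalabanUV.Beta.GAN24.Capacitance (bordered_inverse amp_zero')
open Summit.QuantumFields.BalabanUV.Beta.GAN24.CombesThomasFibre (fibInv legIdx)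
open Summit.QuantumFields.BalabanUV.Beta.GAN24.CombesThomasFibreStep (legOff kFibW kFib cphase_add_eq_mul)
open Summit.QuantumFields.BalabanUV.Beta.GAN24.FibInvClosedForm (fibInv_eq_inv_apply isUnit_det_fibreMatrix norm_blochChar_ofRealVec)

namespace Summit.QuantumFields.BalabanUV.Beta.GAN24.KFibLegSource

variable {d N : ℕ} [NeZero N]

/-! ## §1 Linearity: weighted sums of inverse-fibre entries are entries of `(fibreMatrix)⁻¹ *ᵥ r` -/

/-- [folklore] `Σ_j fibInv N i j p · r j = ((fibreMatrix (blochChar p))⁻¹ *ᵥ r) i` (every complex `p`). -/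
theorem sum_fibInv_mul (p : Fin (d + 1) → ℂ) (r : Idx (d + 1) N → ℂ) (i : Idx (d + 1) N) :
    ∑ j, fibInv N i j p * r j = ((fibreMatrix (N := N) (⇑(blochChar p)))⁻¹ *ᵥ r) i := by
  simp only [Matrix.mulVec, dotProduct, fibInv_eq_inv_apply]

/-- [folklore] At REAL quasi-momentum `(fibreMatrix (blochChar p))⁻¹ *ᵥ r` solves the fibre system with right-hand side `r`. -/
theorem fibreFun_invMulVec (q : Fin (d + 1) → ℝ) (r : Idx (d + 1) N → ℂ) :
    fibreFun (⇑(blochChar (ofRealVec q))) ((fibreMatrix (N := N) (⇑(blochChar (ofRealVec q))))⁻¹ *ᵥ r) = r := by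
  rw [← fibreMatrix_mulVec, Matrix.mulVec_mulVec, Matrix.mul_nonsing_inv _ (isUnit_det_fibreMatrix q), Matrix.one_mulVec]

/-- [folklore] MULTIPLIER ENTRIES of `(fibreMatrix)⁻¹ *ᵥ r`: `= φ κ` for ANY capacitance solution `(φ, c)` with the sources of `r`. -/
theorem invMulVec_inr_inr (q : Fin (d + 1) → ℝ) (hL : ∀ m : TorusSite (d + 1) N, lapSym (kFine (ofRealVec q) m) ≠ 0) (r : Idx (d + 1) N → ℂ)
    {φ : Fin (d + 1) → ℂ} {c : ℂ}
    (hcap : CapSolves (aliasFibre (ofRealVec q) hL) (srcEL (ofRealVec q) r) (srcG (ofRealVec q) r) (r (Sum.inr (Sum.inl 0)))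
      (fun κ => r (Sum.inr (Sum.inr κ))) φ c) (κ : Fin (d + 1)) :
    ((fibreMatrix (N := N) (⇑(blochChar (ofRealVec q))))⁻¹ *ᵥ r) (Sum.inr (Sum.inr κ)) = φ κ :=
  (bordered_inverse (ofRealVec q) (norm_blochChar_ofRealVec q) hL (fibreFun_invMulVec q r) hcap).1 κ

/-- [folklore] FIELD ENTRIES of `(fibreMatrix)⁻¹ *ᵥ r`: the synthesis of leaf-15's per-alias formula, for ANY capacitance solution with the sources of `r`. -/
theorem invMulVec_inl (q : Fin (d + 1) → ℝ) (hL : ∀ m : TorusSite (d + 1) N, lapSym (kFine (ofRealVec q) m) ≠ 0) (r : Idx (d + 1) N → ℂ)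
    {φ : Fin (d + 1) → ℂ} {c : ℂ}
    (hcap : CapSolves (aliasFibre (ofRealVec q) hL) (srcEL (ofRealVec q) r) (srcG (ofRealVec q) r) (r (Sum.inr (Sum.inl 0)))
      (fun κ => r (Sum.inr (Sum.inr κ))) φ c) (κ : Fin (d + 1)) (z : TorusSite (d + 1) N) :
    ((fibreMatrix (N := N) (⇑(blochChar (ofRealVec q))))⁻¹ *ᵥ r) (Sum.inl (κ, z))
      = ∑ m : TorusSite (d + 1) N, Ablk (aliasFibre (ofRealVec q) hL) (srcEL (ofRealVec q) r) (srcG (ofRealVec q) r) φ c m κ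
          * pw (kFine (ofRealVec q) m) (repZ z) :=
  (bordered_inverse (ofRealVec q) (norm_blochChar_ofRealVec q) hL (fibreFun_invMulVec q r) hcap).2.1 κ z

/-! ## §2 The leg source vector and its sources -/

/-- [folklore] The Bloch phase IS an2's Bloch character: `cphase a p = blochChar p a`. -/
theorem cphase_eq_blochChar (a : Site (d + 1)) (p : Fin (d + 1) → ℂ) : cphase a p = blochChar p a := by
  rw [blochChar_apply]; rfl

/-- [folklore] `cphase (−a) p · cphase a p = 1`. -/
theorem cphase_neg_mul (a : Site (d + 1)) (p : Fin (d + 1) → ℂ) : cphase (-a) p * cphase a p = 1 := by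
  rw [← cphase_add_eq_mul, neg_add_cancel]
  unfold cphase; simp

/-- [folklore] THE REFLECTED PLANE WAVE AT A FINE POINT factors through the block: `pw(−k_m) x = cphase(−quo N x) p · pw(−k_m)(repZ (proj N x))`. -/
theorem pw_neg_kFine_site (p : Fin (d + 1) → ℂ) (m : TorusSite (d + 1) N) (x : Site (d + 1)) :
    pw (-kFine p m) x = cphase (-quo N x) p * pw (-kFine p m) (repZ (Torus.proj N x)) := by
  rw [pw_neg, pw_kFine_site p m x, mul_inv, pw_neg, ← cphase_eq_blochChar]
  congr 1
  have h := cphase_neg_mul (quo N x) p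
  have hne : cphase (quo N x) p ≠ 0 := by unfold cphase; exact Complex.exp_ne_zero _
  field_simp
  rw [mul_comm] at h
  exact h.symm

/-- [folklore] THE PLANE WAVE AT A FINE POINT: `cphase(quo N x) p · pw k_m (repZ (proj N x)) = pw k_m x`. -/
theorem cphase_mul_pw_kFine_repZ (p : Fin (d + 1) → ℂ) (m : TorusSite (d + 1) N) (x : Site (d + 1)) :
    cphase (quo N x) p * pw (kFine p m) (repZ (Torus.proj N x)) = pw (kFine p m) x := by
  rw [pw_kFine_site p m x, cphase_eq_blochChar]

/-- [folklore] THE LEG SOURCE VECTOR: the `b`-leg sum of `kFibW` with its weights and reflected phases, as a right-hand side of the fibre system. -/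
def legSrcVec (N : ℕ) [NeZero N] (M : ℕ) (p : Fin (d + 1) → ℂ) (C : ℂ) (b : Fib d) (y' : Site (d + 1)) : Idx (d + 1) N → ℂ :=
  fun j => ∑ i' ∈ legSet d M b, C * cphase (-quo N (legPt M b y' i')) p * Pi.single (M := fun _ : Idx (d + 1) N => ℂ) (legIdx N b (legPt M b y' i')) (1 : ℂ) j

/-- [folklore] THE M-LEVEL SOURCE WEIGHT of a field leg `l` based at the coarse point `y′`: `Σ_{i′ ∈ LegIdx d M} pw(−k_m)(legPt M (inl l) y′ i′)`
(= `conj(e^{ik_m·My′} S_M(m) s_{M,l}(m))` of S1c at real `p`). -/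
def srcW (N : ℕ) [NeZero N] (M : ℕ) (p : Fin (d + 1) → ℂ) (l : Fin (d + 1)) (y' : Site (d + 1)) (m : TorusSite (d + 1) N) : ℂ :=
  ∑ i' ∈ LegIdx d M, pw (-kFine p m) (legPt M (Sum.inl l : Fib d) y' i')

/-- [folklore] THE M-LEVEL READING WEIGHT of a field leg `κ` based at `x′`: `Σ_{i ∈ LegIdx d M} pw k_m (legPt M (inl κ) x′ i)` (= `e^{ik_m·Mx′} S_M(m) s_{M,κ}(m)`). -/
def readW (N : ℕ) [NeZero N] (M : ℕ) (p : Fin (d + 1) → ℂ) (κ : Fin (d + 1)) (x' : Site (d + 1)) (m : TorusSite (d + 1) N) : ℂ :=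
  ∑ i ∈ LegIdx d M, pw (kFine p m) (legPt M (Sum.inl κ : Fib d) x' i)

/-- [folklore] THE AGGREGATED EL-SOURCE of a field leg: `[κ′ = l] · C · N^{−(d+1)} · srcW`. -/
def fieldLegSrc (N : ℕ) [NeZero N] (M : ℕ) (p : Fin (d + 1) → ℂ) (C : ℂ) (l : Fin (d + 1)) (y' : Site (d + 1)) :
    TorusSite (d + 1) N → Fin (d + 1) → ℂ :=
  fun m κ' => if κ' = l then C * (((N : ℂ) ^ (d + 1))⁻¹) * srcW N M p l y' m else 0

/-- [folklore] **WEIGHTED SUMS OF `fibInv` OVER THE `b`-LEGS ARE ENTRIES OF `(fibreMatrix)⁻¹ *ᵥ legSrcVec`.** -/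
theorem sum_leg_fibInv_eq_invMulVec (M : ℕ) (p : Fin (d + 1) → ℂ) (C : ℂ) (b : Fib d) (y' : Site (d + 1)) (i : Idx (d + 1) N) :
    ∑ i' ∈ legSet d M b, C * cphase (-quo N (legPt M b y' i')) p * fibInv N i (legIdx N b (legPt M b y' i')) p
      = ((fibreMatrix (N := N) (⇑(blochChar p)))⁻¹ *ᵥ legSrcVec N M p C b y') i := by
  rw [← sum_fibInv_mul]
  unfold legSrcVec
  simp_rw [Finset.mul_sum]
  rw [Finset.sum_comm]
  refine Finset.sum_congr rfl fun i' _ => ?_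
  rw [Finset.sum_eq_single (legIdx N b (legPt M b y' i'))]
  · simp only [Pi.single_eq_same, mul_one]; ring
  · intro j _ hj; simp [hj]
  · intro h; exact absurd (Finset.mem_univ _) h

/-- [folklore] A field-leg source vector has no `G`/`M`/`Q` components: it vanishes off the `inl` indices. -/
theorem legSrcVec_inl_apply_inr (M : ℕ) (p : Fin (d + 1) → ℂ) (C : ℂ) (l : Fin (d + 1)) (y' : Site (d + 1)) (w : TorusSite (d + 1) N ⊕ Fin (d + 1)) :
    legSrcVec N M p C (Sum.inl l) y' (Sum.inr w) = 0 := by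
  unfold legSrcVec
  refine Finset.sum_eq_zero fun i' _ => ?_
  simp [legIdx]

/-- [folklore] EL-SOURCE of the field-leg source vector: `srcEL p (legSrcVec … (inl l) y′) = fieldLegSrc …` (Bloch aggregation of the reflected plane waves). -/
theorem srcEL_legSrcVec_inl (M : ℕ) (p : Fin (d + 1) → ℂ) (C : ℂ) (l : Fin (d + 1)) (y' : Site (d + 1)) :
    srcEL p (legSrcVec N M p C (Sum.inl l) y') = fieldLegSrc N M p C l y' := by
  funext m κ'
  unfold srcEL amp legSrcVec fieldLegSrc
  by_cases h : κ' = l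
  · subst h
    rw [if_pos rfl]
    unfold srcW
    -- push the scalars inside, swap the box sum and the leg sum, then evaluate the box delta
    simp_rw [Finset.sum_mul, Finset.mul_sum]
    rw [Finset.sum_comm]
    refine Finset.sum_congr rfl fun i' _ => ?_
    rw [Finset.sum_eq_single (Torus.proj N (legPt M (Sum.inl κ' : Fib d) y' i'))]
    · simp only [legIdx, Pi.single_eq_same, mul_one]
      rw [pw_neg_kFine_site p m (legPt M (Sum.inl κ' : Fib d) y' i')]
      ring
    · intro z _ hz
      simp only [legIdx]
      rw [Pi.single_apply, if_neg]
      · ring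
      · intro hh
        simp only [Sum.inl.injEq, Prod.mk.injEq] at hh
        exact hz hh.2
    · intro hh; exact absurd (Finset.mem_univ _) hh
  · rw [if_neg h]
    have : ∀ z : TorusSite (d + 1) N, (∑ i' ∈ legSet d M (Sum.inl l : Fib d), C * cphase (-quo N (legPt M (Sum.inl l : Fib d) y' i')) p *
        Pi.single (M := fun _ : Idx (d + 1) N => ℂ) (legIdx N (Sum.inl l : Fib d) (legPt M (Sum.inl l : Fib d) y' i')) (1 : ℂ) (Sum.inl (κ', z))) = 0 := by
      intro z
      refine Finset.sum_eq_zero fun i' _ => ?_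
      simp only [legIdx]
      rw [Pi.single_apply, if_neg]
      · ring
      · intro hh
        simp only [Sum.inl.injEq, Prod.mk.injEq] at hh
        exact h hh.1
    simp_rw [this]
    simp

/-- [folklore] G-SOURCE of the field-leg source vector: zero. -/
theorem srcG_legSrcVec_inl (M : ℕ) (p : Fin (d + 1) → ℂ) (C : ℂ) (l : Fin (d + 1)) (y' : Site (d + 1)) :
    srcG p (legSrcVec N M p C (Sum.inl l) y') = 0 := by
  funext m
  unfold srcG
  have : rG (legSrcVec N M p C (Sum.inl l) y') = (0 : TorusSite (d + 1) N → ℂ) := by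
    funext z; unfold rG
    split_ifs
    · rfl
    · exact legSrcVec_inl_apply_inr M p C l y' _
  rw [this]
  exact amp_zero' p m

/-- [folklore] M-slot of the field-leg source vector: zero. -/
theorem legSrcVec_inl_M (M : ℕ) (p : Fin (d + 1) → ℂ) (C : ℂ) (l : Fin (d + 1)) (y' : Site (d + 1)) :
    legSrcVec N M p C (Sum.inl l) y' (Sum.inr (Sum.inl 0)) = 0 :=
  legSrcVec_inl_apply_inr M p C l y' _

/-- [folklore] Q-slots of the field-leg source vector: zero. -/
theorem legSrcVec_inl_Q (M : ℕ) (p : Fin (d + 1) → ℂ) (C : ℂ) (l : Fin (d + 1)) (y' : Site (d + 1)) :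
    (fun κ => legSrcVec N M p C (Sum.inl l) y' (Sum.inr (Sum.inr κ))) = 0 := by
  funext κ; exact legSrcVec_inl_apply_inr M p C l y' _

/-- [folklore] THE MULTIPLIER-LEG SOURCE VECTOR is one scaled unit vector: `C · cphase(−quo N (M•y′)) p • e_{inr (inr l)}`. -/
theorem legSrcVec_inr_apply (M : ℕ) (p : Fin (d + 1) → ℂ) (C : ℂ) (l : Fin (d + 1)) (y' : Site (d + 1)) (j : Idx (d + 1) N) :
    legSrcVec N M p C (Sum.inr l) y' j
      = C * cphase (-quo N ((M : ℤ) • y')) p * Pi.single (M := fun _ : Idx (d + 1) N => ℂ) (Sum.inr (Sum.inr l)) (1 : ℂ) j := by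
  unfold legSrcVec
  simp [legSet, legPt, legIdx]

/-- [folklore] EL-source of the multiplier-leg source vector: zero. -/
theorem srcEL_legSrcVec_inr (M : ℕ) (p : Fin (d + 1) → ℂ) (C : ℂ) (l : Fin (d + 1)) (y' : Site (d + 1)) :
    srcEL p (legSrcVec N M p C (Sum.inr l) y') = 0 := by
  funext m κ
  unfold srcEL
  have : (fun z : TorusSite (d + 1) N => legSrcVec N M p C (Sum.inr l) y' (Sum.inl (κ, z))) = 0 := by
    funext z; rw [legSrcVec_inr_apply]; simp
  rw [this]
  exact amp_zero' p m

/-- [folklore] G-source of the multiplier-leg source vector: zero. -/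
theorem srcG_legSrcVec_inr (M : ℕ) (p : Fin (d + 1) → ℂ) (C : ℂ) (l : Fin (d + 1)) (y' : Site (d + 1)) :
    srcG p (legSrcVec N M p C (Sum.inr l) y') = 0 := by
  funext m
  unfold srcG
  have : rG (legSrcVec N M p C (Sum.inr l) y') = (0 : TorusSite (d + 1) N → ℂ) := by
    funext z; unfold rG
    split_ifs
    · rfl
    · rw [legSrcVec_inr_apply]; simp
  rw [this]
  exact amp_zero' p m

/-- [folklore] M-slot of the multiplier-leg source vector: zero. -/
theorem legSrcVec_inr_M (M : ℕ) (p : Fin (d + 1) → ℂ) (C : ℂ) (l : Fin (d + 1)) (y' : Site (d + 1)) :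
    legSrcVec N M p C (Sum.inr l) y' (Sum.inr (Sum.inl 0)) = 0 := by
  rw [legSrcVec_inr_apply]; simp

/-- [folklore] Q-slots of the multiplier-leg source vector: `C · cphase(−quo N (M•y′)) p • e_l`. -/
theorem legSrcVec_inr_Q (M : ℕ) (p : Fin (d + 1) → ℂ) (C : ℂ) (l : Fin (d + 1)) (y' : Site (d + 1)) :
    (fun κ => legSrcVec N M p C (Sum.inr l) y' (Sum.inr (Sum.inr κ)))
      = fun κ => if κ = l then C * cphase (-quo N ((M : ℤ) • y')) p else 0 := by
  funext κ
  rw [legSrcVec_inr_apply]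
  by_cases h : κ = l
  · subst h; simp
  · simp [h]

end Summit.QuantumFields.BalabanUV.Beta.GAN24.KFibLegSource

end
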